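import Literature.MathematicalPhysics.QuantumLattice.HubbardUVCovarianceDetBound
import HarnessLib

/-!
# The determinant bound for the whole ultraviolet block `w_{Λ₀}·p_θ` of the shifted Hubbard covariance (top remainder folded in)

Topic `MathematicalPhysics/QuantumLattice`; companion of `HubbardUVCovarianceDetBound.lean` (cell gate-hubbard-kl, R0-SCOPE-4 F6).  There the
Pedra–Salmhofer bound was proved for `C_uv = (χ - 1 + w_{Λ₀})·p_θ`, leaving the sharp top remainder `R_M = (1 - χ)·p_θ` as a separate
Gaussian step.  The proof only used `C_uv = C_χ - C_{p_B}` with a Gram-bounded `p_B`; here it is re-run for an ARBITRARY Gram part `p_B`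
(`isDetBoundedR_gridSub_fejer_sub_gram`) and specialised to `p_B = (χ - w_{Λ₀})·p_θ`, i.e. to the block
`hubbardCovTopShifted + hubbardCovUVShifted = w_{Λ₀}·p_θ` — everything above the infrared scale `Λ₀` in ONE chronological step, the top
remainder riding in the Gram part (its Gram constant is `≤ (4/3)/π`, uniformly in `M`):

* **`isDetBoundedR_gridSub_fejer_sub_gram`** — `IsDetBoundedR q (Sᵀ (C_χ - C_{p_B}) S) (2√(1+κ²))`;
* `hubbardCovTopShifted_add_uv_eq` — `top + uv = C_χ - C_{(χ - w)·p_θ}`;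
* **`isDetBoundedR_gridSub_hubbardCovTopAddUV`** — the bound for `Sᵀ (top + uv) S`.

Everything is PROVED; no definitions, no named facts.

## Sources

W. de Siqueira Pedra, M. Salmhofer, Comm. Math. Phys. 282 (2008) 797–818, Thm 2.4 [`PedraSalmhofer2008`];
G. Benfatto, A. Giuliani, V. Mastropietro, Ann. Henri Poincaré 7 (2006) 809–898, §2.2 (2.10), App. A1 [`BenfattoGiulianiMastropietro2006`].
-/

noncomputable section

open Finset Set MeasureTheory

open scoped InnerProductSpace ComplexConjugate

namespace Literature.MathematicalPhysics.QuantumLattice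

open Literature.Probability.LatticeModels GrassmannAlgebra

section Aux

/-- The two-point function is additive in the covariance. [folklore] -/
private theorem contr_sub_apply {Γ : Type*} (A B : Matrix Γ Γ ℂ) (X Y : Γ) :
    contr ℂ (A - B) X Y = contr ℂ A X Y - contr ℂ B X Y := by
  simp only [contr_apply, Matrix.sub_apply]
  ring

/-- For an antisymmetric covariance the two-point function is `-C(X, Y)`. [folklore] -/
private theorem contr_apply_of_transpose_eq_neg {Γ : Type*} {A : Matrix Γ Γ ℂ} (h : A.transpose = -A) (X Y : Γ) :
    contr ℂ A X Y = -A X Y := by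
  have h1 : A Y X = -A X Y := by
    have := congrFun (congrFun h X) Y
    rwa [Matrix.transpose_apply, Matrix.neg_apply] at this
  rw [contr_apply, h1, Rat.smul_one_eq_cast]
  push_cast
  ring

/-- `|z| · (z/|z|) = z`. [folklore] -/
private theorem norm_mul_div_norm_self (z : ℂ) : ((‖z‖ : ℝ) : ℂ) * (z / ((‖z‖ : ℝ) : ℂ)) = z := by
  by_cases hz : z = 0
  · simp [hz]
  · have h : ((‖z‖ : ℝ) : ℂ) ≠ 0 := by exact_mod_cast (norm_ne_zero_iff.2 hz)
    field_simp

/-- `|z/|z|| ≤ 1`. [folklore] -/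
private theorem norm_div_norm_le_one (z : ℂ) : ‖z / ((‖z‖ : ℝ) : ℂ)‖ ≤ 1 := by
  by_cases hz : z = 0
  · simp [hz]
  · rw [norm_div, Complex.norm_real, norm_norm, div_self (norm_ne_zero_iff.2 hz)]

end Aux

section Main

variable {L M : ℕ} [NeZero L]

/-- **The Pedra–Salmhofer determinant bound for a Fejér-truncated covariance minus a Gram part, on the time grid**: for `0 < β`,
`|βθ| ≤ π/4`, `0 < M`, any symbol `p_B` and any bound `κ` of its grid Gram vectors, the pulled-back covariance
`Sᵀ (C_χ - C_{p_B}) S` (`C_χ` = normal covariance with symbol `χ_n p_θ`, `χ` the Fejér top weight; `S = hubbardGridSub`, charge-`0` legs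
as rows) satisfies `IsDetBoundedR q (Sᵀ (C_χ - C_{p_B}) S) (2 √(1 + κ²))`, uniformly in `M`, `N`, `L`. [cite: PedraSalmhofer2008, Thm 2.4] -/
theorem isDetBoundedR_gridSub_fejer_sub_gram {β : ℝ} (hβ : 0 < β) (μ : ℝ) {θ : ℝ} (hθ : |β * θ| ≤ Real.pi / 4)
    (hM : 0 < M) (N : ℕ) (pB : FreqMomentum L M × Fin 2 → ℂ) {κ : ℝ}
    (hF : ∀ X : GridLeg (GridPoint L N), ‖gridGramF L M β (fun p : GridPoint L N => p.2) (fun p => gridTime β N p.1)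
        pB X‖ ≤ κ)
    (hG : ∀ Y : GridLeg (GridPoint L N), ‖gridGramG L M β (fun p : GridPoint L N => p.2) (fun p => gridTime β N p.1)
        pB Y‖ ≤ κ) :
    IsDetBoundedR (fun X : GridLeg (GridPoint L N) => decide (X.2 = 0))
      ((hubbardGridSub L M β N).transpose *
        (normalCovariance L M (fun ks => ((topWeight L M ks.1 : ℝ) : ℂ) * shiftedFreeSymbol L M β μ θ ks) -
          normalCovariance L M pB) * hubbardGridSub L M β N)
      (2 * Real.sqrt (1 + κ ^ 2)) := by
  classical
  intro n a u u' hu hu' Xb Xu hb hub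
  have hXb : ∀ i, (Xb i).2 = 0 := fun i => of_decide_eq_true (hb i)
  have hXu : ∀ j, (Xu j).2 = 1 := fun j => Fin.eq_one_of_ne_zero _ (of_decide_eq_false (hub j))
  have hτc : ∀ j, gridTime β N (Xu j).1.1.1 ∈ Icc 0 β := fun j => gridTime_mem_Icc hβ.le _
  simp only [hubbardGridSub]
  -- the Fejér kernel, the weights and the phases of the rows
  set Fχ := freqKernel β (matsubaraFreq β M) (fun i => ((fejerWeight M (matsubaraInt M i) : ℝ) : ℂ)) with hFχ
  set φ : Fin a → ℝ → ℂ := fun i s => ((‖Fχ (gridTime β N (Xb i).1.1.1 - s)‖ : ℝ) : ℂ) with hφ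
  set ph : Fin a → ℝ → ℂ := fun i s =>
    Fχ (gridTime β N (Xb i).1.1.1 - s) / ((‖Fχ (gridTime β N (Xb i).1.1.1 - s)‖ : ℝ) : ℂ) with hph
  have hφph : ∀ i s, φ i s * ph i s = Fχ (gridTime β N (Xb i).1.1.1 - s) := fun i s => norm_mul_div_norm_self _
  have hph1 : ∀ i s, ‖ph i s‖ ≤ 1 := fun i s => norm_div_norm_le_one _
  -- the momentum sum of chronological kernels between row `i` and column `j`
  set Ksum : Fin a → Fin a → ℝ → ℂ := fun i j s =>
    ∑ kv : TorusSite 2 L, ((1 / (L : ℝ) : ℝ) : ℂ) *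
        Complex.exp (((∑ l, latticeMomentum L kv l * (((Xb i).1.1.2 l).val : ℝ) : ℝ) : ℂ) * Complex.I) *
      (((1 / (L : ℝ) : ℝ) : ℂ) *
        Complex.exp (-(((∑ l, latticeMomentum L kv l * (((Xu j).1.1.2 l).val : ℝ) : ℝ) : ℂ) * Complex.I))) *
      fermiTimeKernel β ((nambuXi L μ kv : ℂ) - (θ : ℂ) * Complex.I) s (gridTime β N (Xu j).1.1.1) with hKsum
  -- the frozen data
  set Ff : Fin a → ℝ → (TorusSite 2 L × Fin 2) × Fin n → ℂ := fun i s m =>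
    -(ph i s * ((if m.1.2 = (Xb i).1.2 then 1 else 0) * (((1 / (L : ℝ) : ℝ) : ℂ) *
        Complex.exp (((∑ l, latticeMomentum L m.1.1 l * (((Xb i).1.1.2 l).val : ℝ) : ℝ) : ℂ) * Complex.I))) *
      ((u i m.2 : ℝ) : ℂ)) with hFf
  set Gf : Fin a → (TorusSite 2 L × Fin 2) × Fin n → ℂ := fun j m =>
    ((if m.1.2 = (Xu j).1.2 then 1 else 0) * (((1 / (L : ℝ) : ℝ) : ℂ) *
        Complex.exp (-(((∑ l, latticeMomentum L m.1.1 l * (((Xu j).1.1.2 l).val : ℝ) : ℝ) : ℂ) * Complex.I)))) *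
      ((u' j m.2 : ℝ) : ℂ) with hGf
  set Pf : Fin a → (FreqMomentum L M × Fin 2) × Fin n → ℂ := fun i m' =>
    -conj (gridGramF L M β (fun p : GridPoint L N => p.2) (fun p => gridTime β N p.1)
        pB (Xb i) m'.1) *
      ((u i m'.2 : ℝ) : ℂ) with hPf
  set Qf : Fin a → (FreqMomentum L M × Fin 2) × Fin n → ℂ := fun j m' =>
    gridGramG L M β (fun p : GridPoint L N => p.2) (fun p => gridTime β N p.1)
        pB (Xu j) m'.1 *
      ((u' j m'.2 : ℝ) : ℂ) with hQf
  set 𝔄 : Fin a → Fin a → ℝ → ℂ := fun i j s =>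
    (∑ m, Ff i s m * Gf j m *
        fermiTimeKernel β ((nambuXi L μ m.1.1 : ℂ) - (θ : ℂ) * Complex.I) ((Set.projIcc 0 β hβ.le s : ℝ))
          (gridTime β N (Xu j).1.1.1)) +
      ∑ m', Pf i m' * Qf j m' with h𝔄
  -- (1) the frozen entries in closed form
  have h𝔄eq : ∀ i j s, 𝔄 i j s =
      -(ph i s * (((⟪u i, u' j⟫_ℝ : ℝ) : ℂ) * ((if (Xb i).1.2 = (Xu j).1.2 then 1 else 0) *
          Ksum i j (Set.projIcc 0 β hβ.le s : ℝ)))) -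
        ((⟪u i, u' j⟫_ℝ : ℝ) : ℂ) *
          ⟪gridGramF L M β (fun p : GridPoint L N => p.2) (fun p => gridTime β N p.1)
              pB (Xb i),
            gridGramG L M β (fun p : GridPoint L N => p.2) (fun p => gridTime β N p.1)
              pB (Xu j)⟫_ℂ := by
    intro i j s
    simp only [h𝔄, hFf, hGf, hPf, hQf, hKsum]
    rw [sum_frozen_modes_eq (ph i s) (Xb i).1.2 (Xu j).1.2
        (fun kv => ((1 / (L : ℝ) : ℝ) : ℂ) *
          Complex.exp (((∑ l, latticeMomentum L kv l * (((Xb i).1.1.2 l).val : ℝ) : ℝ) : ℂ) * Complex.I))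
        (fun kv => ((1 / (L : ℝ) : ℝ) : ℂ) *
          Complex.exp (-(((∑ l, latticeMomentum L kv l * (((Xu j).1.1.2 l).val : ℝ) : ℝ) : ℂ) * Complex.I)))
        (fun kv => fermiTimeKernel β ((nambuXi L μ kv : ℂ) - (θ : ℂ) * Complex.I) ((Set.projIcc 0 β hβ.le s : ℝ))
          (gridTime β N (Xu j).1.1.1)) (u i) (u' j),
      sum_gram_modes_eq]
    ring
  -- (2) the weighted integrand, pointwise
  have hφ𝔄 : ∀ i j s, φ i s * 𝔄 i j s =
      -(((⟪u i, u' j⟫_ℝ : ℝ) : ℂ) * (if (Xb i).1.2 = (Xu j).1.2 then 1 else 0)) *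
          (Fχ (gridTime β N (Xb i).1.1.1 - s) * Ksum i j (Set.projIcc 0 β hβ.le s : ℝ)) +
        (-(((⟪u i, u' j⟫_ℝ : ℝ) : ℂ) *
          ⟪gridGramF L M β (fun p : GridPoint L N => p.2) (fun p => gridTime β N p.1)
              pB (Xb i),
            gridGramG L M β (fun p : GridPoint L N => p.2) (fun p => gridTime β N p.1)
              pB (Xu j)⟫_ℂ)) *
          φ i s := by
    intro i j s
    rw [h𝔄eq, ← hφph i s]
    ring
  -- (3) continuity and integrability
  have hFcont : ∀ i, Continuous fun s : ℝ => Fχ (gridTime β N (Xb i).1.1.1 - s) := fun i =>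
    (continuous_freqKernel _ _ _).comp (continuous_const.sub continuous_id)
  have hφcont : ∀ i, Continuous (φ i) := fun i =>
    Complex.continuous_ofReal.comp (continuous_norm.comp (hFcont i))
  have hIφ : ∀ i, Integrable (φ i) (volume.restrict (Ioc 0 β)) := fun i =>
    ((hφcont i).intervalIntegrable 0 β).1
  have hKint : ∀ i j, IntervalIntegrable (fun s => Ksum i j s) volume 0 β := by
    intro i j
    rw [intervalIntegrable_iff_integrableOn_Ioc_of_le hβ.le]
    simp only [hKsum]
    exact integrable_finsetSum _ fun kv _ =>
      (((intervalIntegrable_fermiTimeKernel _ (hτc j)).const_mul _).1 :)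
  have hFKint : ∀ i j, IntegrableOn (fun s => Fχ (gridTime β N (Xb i).1.1.1 - s) * Ksum i j s) (Ioc 0 β) := fun i j =>
    ((hKint i j).continuousOn_mul (hFcont i).continuousOn).1
  have hprojeq : ∀ i j, EqOn (fun s => Fχ (gridTime β N (Xb i).1.1.1 - s) * Ksum i j (Set.projIcc 0 β hβ.le s : ℝ))
      (fun s => Fχ (gridTime β N (Xb i).1.1.1 - s) * Ksum i j s) (Ioc 0 β) := by
    intro i j s hs
    simp only [Set.projIcc_of_mem hβ.le ⟨hs.1.le, hs.2⟩]
  have hFKint' : ∀ i j, IntegrableOn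
      (fun s => Fχ (gridTime β N (Xb i).1.1.1 - s) * Ksum i j (Set.projIcc 0 β hβ.le s : ℝ)) (Ioc 0 β) := fun i j =>
    (hFKint i j).congr_fun (hprojeq i j).symm measurableSet_Ioc
  have hIφ𝔄 : ∀ i j, Integrable (fun s => φ i s * 𝔄 i j s) (volume.restrict (Ioc 0 β)) := by
    intro i j
    rw [show (fun s => φ i s * 𝔄 i j s) = _ from funext (hφ𝔄 i j)]
    exact ((hFKint' i j).const_mul _).add ((hIφ i).const_mul _)
  -- (4) the weights integrate to one
  have hφone : ∀ i, ∫ s in Ioc 0 β, ‖φ i s‖ = 1 := by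
    intro i
    simp only [hφ, Complex.norm_real, norm_norm]
    rw [← intervalIntegral.integral_of_le hβ.le]
    exact integral_norm_freqKernel_fejer_sub hβ hM _
  have hφoneC : ∀ i, ∫ s in Ioc 0 β, φ i s = 1 := by
    intro i
    simp only [hφ]
    rw [integral_complex_ofReal, ← intervalIntegral.integral_of_le hβ.le, integral_norm_freqKernel_fejer_sub hβ hM,
      Complex.ofReal_one]
  -- (5) the entry identity
  have hentry : ∀ i j, ((⟪u i, u' j⟫_ℝ : ℝ) : ℂ) *
      contr ℂ ((gridSubMatrix L M β (fun p : GridPoint L N => p.2) (fun p => gridTime β N p.1)).transpose *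
        (normalCovariance L M (fun ks => ((topWeight L M ks.1 : ℝ) : ℂ) * shiftedFreeSymbol L M β μ θ ks) -
          normalCovariance L M pB) *
        gridSubMatrix L M β (fun p : GridPoint L N => p.2) (fun p => gridTime β N p.1)) (Xb i) (Xu j) =
      ∫ s in Ioc 0 β, φ i s * 𝔄 i j s := by
    intro i j
    rw [Matrix.mul_sub, Matrix.sub_mul, contr_sub_apply,
      contr_apply_of_transpose_eq_neg (gridSub_pullback_normalCovariance_transpose β _ _
        (fun ks => ((topWeight L M ks.1 : ℝ) : ℂ) * shiftedFreeSymbol L M β μ θ ks)) (Xb i) (Xu j),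
      contr_gridSub_pullback_normalCovariance_eq_inner β _ _ _ (hXb i) (hXu j),
      gridSub_pullback_top_apply hβ hθ μ (Xb i) (Xu j) (hXb i) (hXu j)]
    rw [show (fun s => φ i s * 𝔄 i j s) = _ from funext (hφ𝔄 i j), integral_add ((hFKint' i j).const_mul _)
      ((hIφ i).const_mul _), integral_const_mul, integral_const_mul, setIntegral_congr_fun measurableSet_Ioc (hprojeq i j),
      ← intervalIntegral.integral_of_le hβ.le, hφoneC i]
    simp only [hKsum]
    ring
  -- (6) the frozen determinant bound, uniformly in the times
  have hFrow : ∀ i s, ∑ m, ‖Ff i s m‖ ^ 2 ≤ 1 := by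
    intro i s
    simp only [hFf, norm_neg]
    refine sum_norm_sq_frozen_row_le (ph i s) (hph1 i s) (Xb i).1.2
      (fun kv => ((1 / (L : ℝ) : ℝ) : ℂ) *
        Complex.exp (((∑ l, latticeMomentum L kv l * (((Xb i).1.1.2 l).val : ℝ) : ℝ) : ℂ) * Complex.I))
      (fun kv => ?_) (u i) (hu i)
    rw [norm_mul, Complex.norm_exp_ofReal_mul_I, mul_one, Complex.norm_real, Real.norm_eq_abs, sq_abs, one_div, inv_pow,
      one_div]
  have hGrow : ∀ j, ∑ m, ‖Gf j m‖ ^ 2 ≤ 1 := by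
    intro j
    have h := sum_norm_sq_frozen_row_le (L := L) 1 (by simp) (Xu j).1.2
      (fun kv => ((1 / (L : ℝ) : ℝ) : ℂ) *
        Complex.exp (-(((∑ l, latticeMomentum L kv l * (((Xu j).1.1.2 l).val : ℝ) : ℝ) : ℂ) * Complex.I)))
      (fun kv => ?_) (u' j) (hu' j)
    · simpa only [hGf, one_mul] using h
    · rw [norm_mul, Complex.norm_exp, Complex.norm_real, Real.norm_eq_abs]
      simp
  have hProw : ∀ i, ∑ m', ‖Pf i m'‖ ^ 2 ≤ κ ^ 2 := fun i => by
    simp only [hPf]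
    exact sum_norm_sq_conj_gram_row_le _ (hF _) (u i) (hu i)
  have hQrow : ∀ j, ∑ m', ‖Qf j m'‖ ^ 2 ≤ κ ^ 2 := fun j => by
    simp only [hQf]
    exact sum_norm_sq_gram_col_le _ (hG _) (u' j) (hu' j)
  have hdet : ∀ x : Fin a → ℝ, ‖(Matrix.of fun i j : Fin a => 𝔄 i j (x i)).det‖ ≤
      4 ^ a * ((∏ _i : Fin a, Real.sqrt (1 + κ ^ 2)) * ∏ _j : Fin a, Real.sqrt (1 + κ ^ 2)) := by
    intro x
    simp only [h𝔄]
    refine (norm_det_fermiTimeKernel_add_gram_le hθ (fun m : (TorusSite 2 L × Fin 2) × Fin n => nambuXi L μ m.1.1)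
      (fun i => (Set.projIcc 0 β hβ.le (x i) : ℝ)) (fun j => gridTime β N (Xu j).1.1.1)
      (fun i => (Set.projIcc 0 β hβ.le (x i)).2) hτc (fun i => Ff i (x i)) Gf Pf Qf).trans ?_
    refine mul_le_mul_of_nonneg_left (mul_le_mul (prod_le_prod (fun _ _ => Real.sqrt_nonneg _) fun i _ =>
      Real.sqrt_le_sqrt (add_le_add (hFrow i (x i)) (hProw i))) (prod_le_prod (fun _ _ => Real.sqrt_nonneg _) fun j _ =>
      Real.sqrt_le_sqrt (add_le_add (hGrow j) (hQrow j))) (prod_nonneg fun _ _ => Real.sqrt_nonneg _)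
      (prod_nonneg fun _ _ => Real.sqrt_nonneg _)) (by positivity)
  -- (7) assemble
  have hfinal : ‖(Matrix.of fun i j : Fin a => ∫ s in Ioc 0 β, φ i s * 𝔄 i j s).det‖ ≤
      (2 * Real.sqrt (1 + κ ^ 2)) ^ a * (2 * Real.sqrt (1 + κ ^ 2)) ^ a := by
    refine (Literature.Analysis.Matrix.norm_det_row_integral_le (volume.restrict (Ioc 0 β)) φ 𝔄 hIφ hIφ𝔄 hdet).trans ?_
    rw [prod_eq_one fun i _ => hφone i, mul_one, prod_const, card_univ, Fintype.card_fin, mul_pow,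
      show (4 : ℝ) ^ a = 2 ^ a * 2 ^ a by rw [← mul_pow]; norm_num]
    exact le_of_eq (by ring)
  have hmat : (Matrix.of fun i j : Fin a => ((⟪u i, u' j⟫_ℝ : ℝ) : ℂ) *
      contr ℂ ((gridSubMatrix L M β (fun p : GridPoint L N => p.2) (fun p => gridTime β N p.1)).transpose *
        (normalCovariance L M (fun ks => ((topWeight L M ks.1 : ℝ) : ℂ) * shiftedFreeSymbol L M β μ θ ks) -
          normalCovariance L M pB) *
        gridSubMatrix L M β (fun p : GridPoint L N => p.2) (fun p => gridTime β N p.1)) (Xb i) (Xu j)) =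
      Matrix.of fun i j : Fin a => ∫ s in Ioc 0 β, φ i s * 𝔄 i j s := by
    ext i j
    exact hentry i j
  have h := hmat ▸ hfinal
  exact h

omit [NeZero L] in
/-- `top + uv = C_χ - C_{(χ - w_{Λ₀})·p_θ}`: the block above the infrared scale, `w_{Λ₀}·p_θ`, is the Fejér-truncated covariance minus the
Gram part with symbol `(χ - w_{Λ₀})·p_θ`. [cite: BenfattoGiulianiMastropietro2006, §2.2 (2.10)] -/
theorem hubbardCovTopShifted_add_uv_eq (β μ θ Λ₀ : ℝ) :
    hubbardCovTopShifted L M β μ θ + hubbardCovUVShifted L M β μ θ Λ₀ =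
      normalCovariance L M (fun ks => ((topWeight L M ks.1 : ℝ) : ℂ) * shiftedFreeSymbol L M β μ θ ks) -
        normalCovariance L M (fun ks =>
          ((topWeight L M ks.1 - hubbardCutoffWeight L M β μ Λ₀ ks.1 : ℝ) : ℂ) * shiftedFreeSymbol L M β μ θ ks) := by
  ext X Y
  rw [Matrix.add_apply, Matrix.sub_apply, hubbardCovTopShifted, hubbardCovUVShifted, normalCovariance_apply,
    normalCovariance_apply, normalCovariance_apply, normalCovariance_apply]
  split_ifs <;> push_cast <;> ring

/-- **The Pedra–Salmhofer bound for the whole block above `Λ₀`** (`top + uv`, top remainder folded into the Gram part): for any bound `κ`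
of the grid Gram vectors of `(χ - w_{Λ₀})·p_θ`, `IsDetBoundedR q (Sᵀ (top + uv) S) (2√(1 + κ²))`, uniformly in `M`, `N`, `L`.
[cite: PedraSalmhofer2008, Thm 2.4] -/
theorem isDetBoundedR_gridSub_hubbardCovTopAddUV {β : ℝ} (hβ : 0 < β) (μ : ℝ) {θ : ℝ} (hθ : |β * θ| ≤ Real.pi / 4)
    (hM : 0 < M) (N : ℕ) (Λ₀ : ℝ) {κ : ℝ}
    (hF : ∀ X : GridLeg (GridPoint L N), ‖gridGramF L M β (fun p : GridPoint L N => p.2) (fun p => gridTime β N p.1)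
        (fun ks => ((topWeight L M ks.1 - hubbardCutoffWeight L M β μ Λ₀ ks.1 : ℝ) : ℂ) * shiftedFreeSymbol L M β μ θ ks) X‖ ≤ κ)
    (hG : ∀ Y : GridLeg (GridPoint L N), ‖gridGramG L M β (fun p : GridPoint L N => p.2) (fun p => gridTime β N p.1)
        (fun ks => ((topWeight L M ks.1 - hubbardCutoffWeight L M β μ Λ₀ ks.1 : ℝ) : ℂ) * shiftedFreeSymbol L M β μ θ ks) Y‖ ≤ κ) :
    IsDetBoundedR (fun X : GridLeg (GridPoint L N) => decide (X.2 = 0))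
      ((hubbardGridSub L M β N).transpose * (hubbardCovTopShifted L M β μ θ + hubbardCovUVShifted L M β μ θ Λ₀) *
        hubbardGridSub L M β N)
      (2 * Real.sqrt (1 + κ ^ 2)) := by
  rw [hubbardCovTopShifted_add_uv_eq]
  exact isDetBoundedR_gridSub_fejer_sub_gram hβ μ hθ hM N _ hF hG

end Main

end Literature.MathematicalPhysics.QuantumLattice

end
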